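import Summits.Ventures.HodgeRepro.Faces

/-!
# The pairing pattern of a `SumTwo` quadruple; the converse of `sumTwo_faceCorners` in degrees 6 and 8

Blind re-derivation cell `pub-hodge-repro`, seat `typer` (gen 4).  Continues `Faces.lean`.

`Faces.lean` shows that every face `(Φ; π, π′)` — corners `Φ, (Φ̄)^{(π)}, (Φ̄)^{(π′)}, Φ^{(ππ′)}` — satisfies
`SumTwo` (every embedding lies in exactly two corners).  This file proves the CONVERSE stated in
`route/ROUTE.md` §3.1 ("Conversely every sumTwo quadruple without a conjugate pair has all three
pairings (a missing pairing forces a corner equal to `Φ̄`): in degree 6 (pattern (1,1,1)) and degree 8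
(pattern (2,1,1)) the census faces are ALL the (eq2)-quadruples without conjugate corners"):

* `SumTwo.exists_partner`: for `x ∈ T 0` exactly one other corner contains `x` (its *partner*);
* `shared T i = T 0 ∩ T i` (the embeddings of the first corner paired with corner `i`): the three sets
  `shared T 1, shared T 2, shared T 3` are pairwise disjoint and cover `T 0`
  (`disjoint_shared`, `sum_card_shared`) — their sizes are the *pairing pattern* of §3.1;
* `conj_of_shared_eq_empty` / `conj_of_eq_conj`: one conjugate corner forces the other two corners to
  be conjugate too (the quadruples the sealed census excludes by `noConjugateCorners` are two conjugate
  pairs: a product of two divisor classes); `shared_nonempty` (in `FaceCriterion.lean`): a corner with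
  `shared T i = ∅` IS the conjugate type `c • T 0`, so without a conjugate corner all three pairings occur;
* `corner_eq_flipAt_conj` / `corner_eq_flipAt_flipAt`: if `shared T a = {π}` and `shared T b = {π′}`
  then `T a = (T̄ 0)^{(π)}`, `T b = (T̄ 0)^{(π′)}` and the remaining corner is `(T 0)^{(ππ′)}`: the
  quadruple IS the face `(T 0; π, π′)` up to relabelling the corners (`faceCorners`);
* `isFace_of_two_singleton_shared`: two singleton pairings `{π}`, `{π′}` pin the whole quadruple as
  the face `(T 0; π, π′)`.

The consequences — a quadruple is a face iff two pairings are singletons, the degree-6/8 completeness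
`isFace_of_sumTwo_of_card_le_eight`, the pattern of a face and the relabelling `perm_fin4` — are in
`FaceCriterion.lean`.  Nothing here uses the enumeration of the sealed census; the statements hold for
every finite group `G` with a complex conjugation `c` (`IsComplexConj`).
-/

open Finset
open scoped Pointwise symmDiff

namespace HodgeRepro

variable {G : Type*}

/-! ### The partner of an embedding of the first corner -/

section Partner

variable [DecidableEq G]

/-- **Partner.**  Under `SumTwo`, an embedding `x` of the first corner lies in exactly one other corner
`e ≠ 0`: `x ∈ T i ↔ i = e` for every `i ≠ 0`. -/
theorem SumTwo.exists_partner {T : Fin 4 → Finset G} (hsum : SumTwo T) {x : G} (hx : x ∈ T 0) :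
    ∃ e : Fin 4, e ≠ 0 ∧ ∀ i : Fin 4, i ≠ 0 → (x ∈ T i ↔ i = e) := by
  obtain ⟨u, v, huv, h⟩ := Finset.card_eq_two.1 (hsum x)
  have hmem : ∀ i : Fin 4, x ∈ T i ↔ i = u ∨ i = v := by
    intro i
    have := Finset.ext_iff.1 h i
    simpa using this
  have h0 : (0 : Fin 4) = u ∨ (0 : Fin 4) = v := (hmem 0).1 hx
  rcases h0 with rfl | rfl
  · exact ⟨v, fun hv => huv hv.symm, fun i hi => by
      rw [hmem]; exact ⟨fun h => h.resolve_left hi, Or.inr⟩⟩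
  · exact ⟨u, huv, fun i hi => by
      rw [hmem]; exact ⟨fun h => h.resolve_right hi, Or.inl⟩⟩

/-- The embeddings of the first corner shared with (paired to) corner `i`: `T 0 ∩ T i`. -/
def shared (T : Fin 4 → Finset G) (i : Fin 4) : Finset G := T 0 ∩ T i

/-- Membership in `shared`. -/
theorem mem_shared {T : Fin 4 → Finset G} {i : Fin 4} {x : G} :
    x ∈ shared T i ↔ x ∈ T 0 ∧ x ∈ T i :=
  Finset.mem_inter

/-- `shared T i ⊆ T 0`. -/
theorem shared_subset (T : Fin 4 → Finset G) (i : Fin 4) : shared T i ⊆ T 0 :=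
  Finset.inter_subset_left

/-- The shared sets of two different corners `a, b ≠ 0` are disjoint (an embedding has one partner). -/
theorem disjoint_shared {T : Fin 4 → Finset G} (hsum : SumTwo T) {a b : Fin 4} (ha : a ≠ 0)
    (hb : b ≠ 0) (hab : a ≠ b) : Disjoint (shared T a) (shared T b) := by
  rw [Finset.disjoint_left]
  intro x hxa hxb
  rw [mem_shared] at hxa hxb
  obtain ⟨e, -, he⟩ := hsum.exists_partner hxa.1
  exact hab (((he a ha).1 hxa.2).trans ((he b hb).1 hxb.2).symm)

/-- The three shared sets cover the first corner. -/
theorem eq_biUnion_shared {T : Fin 4 → Finset G} (hsum : SumTwo T) :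
    T 0 = ({1, 2, 3} : Finset (Fin 4)).biUnion (shared T) := by
  have h123 : ∀ e : Fin 4, e ≠ 0 → e = 1 ∨ e = 2 ∨ e = 3 := by decide
  ext x
  simp only [Finset.mem_biUnion, Finset.mem_insert, Finset.mem_singleton, mem_shared]
  constructor
  · intro hx
    obtain ⟨e, he0, he⟩ := hsum.exists_partner hx
    exact ⟨e, h123 e he0, hx, (he e he0).2 rfl⟩
  · rintro ⟨i, -, hx, -⟩
    exact hx

/-- **The pairing pattern sums to the size of the first corner**:
`|shared T 1| + |shared T 2| + |shared T 3| = |T 0|`. -/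
theorem sum_card_shared {T : Fin 4 → Finset G} (hsum : SumTwo T) :
    (shared T 1).card + (shared T 2).card + (shared T 3).card = (T 0).card := by
  have hne : ∀ i : Fin 4, i ∈ ({1, 2, 3} : Finset (Fin 4)) → i ≠ 0 := by decide
  rw [eq_biUnion_shared hsum, Finset.card_biUnion (fun a ha b hb hab =>
    disjoint_shared hsum (hne a ha) (hne b hb) hab)]
  rw [Finset.sum_insert, Finset.sum_insert, Finset.sum_singleton]
  · omega
  · decide
  · decide

end Partner

/-! ### Singleton pairings pin the corners -/

section Corners

variable [Group G]

/-- If `x ∈ Φ` then `c * x ∉ Φ` for a CM type `Φ`. -/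
theorem conj_not_mem_of_mem {c : G} {Φ : Finset G} (hΦ : IsCMType c Φ) {x : G} (hx : x ∈ Φ) :
    c * x ∉ Φ :=
  (hΦ x).1 hx

/-- In `Fin 4`, the index different from `0`, `a`, `b` (three distinct non-zero indices `a, b, d`) is `d`. -/
private theorem fin4_third (a b d e : Fin 4) (ha : a ≠ 0) (hb : b ≠ 0) (hd : d ≠ 0) (hab : a ≠ b)
    (had : a ≠ d) (hbd : b ≠ d) (he0 : e ≠ 0) (hea : e ≠ a) (heb : e ≠ b) : e = d := by
  omega

/-- `x = c * π ↔ c * x = π` for an involution `c`. -/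
private theorem eq_conj_iff {c : G} (hc : IsComplexConj c) {x π : G} : x = c * π ↔ c * x = π := by
  constructor
  · rintro rfl; exact hc.mul_mul_cancel π
  · intro h; rw [← h, hc.mul_mul_cancel]

variable [DecidableEq G]

/-- **A corner paired to `T 0` at the single embedding `π` is `(T̄ 0)^{(π)}`.** -/
theorem corner_eq_flipAt_conj {c : G} (hc : IsComplexConj c) {T : Fin 4 → Finset G}
    (hT : ∀ i, IsCMType c (T i)) {a : Fin 4} {π : G} (h : shared T a = {π}) :
    T a = flipAt c π (c • T 0) := by
  have hπ0 : π ∈ T 0 := (mem_shared.1 (h ▸ Finset.mem_singleton_self π)).1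
  have hmem : ∀ x, x ∈ T 0 → (x ∈ T a ↔ x = π) := by
    intro x hx
    rw [← Finset.mem_singleton, ← h, mem_shared]
    exact ⟨fun h' => ⟨hx, h'⟩, fun h' => h'.2⟩
  have hcπ : c * π ∉ T 0 := conj_not_mem_of_mem (hT 0) hπ0
  ext x
  rw [mem_flipAt, hc.mem_smul_iff, mem_place]
  by_cases hx : x ∈ T 0
  · have hcx : c * x ∉ T 0 := conj_not_mem_of_mem (hT 0) hx
    rw [hmem x hx]
    constructor
    · intro hxπ
      exact Or.inr ⟨Or.inl hxπ, hcx⟩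
    · rintro (⟨h1, -⟩ | ⟨h1 | h1, -⟩)
      · exact absurd h1 hcx
      · exact h1
      · exact absurd (h1 ▸ hx) hcπ
  · have hcx : c * x ∈ T 0 := ((hT 0).conj_mem_iff x).2 hx
    have hxa : x ∈ T a ↔ ¬ c * x = π := by
      rw [hT a x, hmem (c * x) hcx]
    have hxπ : x ≠ π := fun h => hx (h ▸ hπ0)
    rw [hxa, ← eq_conj_iff hc]
    constructor
    · intro h1
      exact Or.inl ⟨hcx, fun h2 => h2.elim hxπ h1⟩
    · rintro (⟨-, h1⟩ | ⟨-, h1⟩)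
      · exact fun h2 => h1 (Or.inr h2)
      · exact absurd hcx h1

/-- **The remaining corner of a quadruple with two singleton pairings is `(T 0)^{(ππ′)}`.** -/
theorem corner_eq_flipAt_flipAt {c : G} (hc : IsComplexConj c) {T : Fin 4 → Finset G}
    (hT : ∀ i, IsCMType c (T i)) (hsum : SumTwo T) {a b d : Fin 4} (ha : a ≠ 0) (hb : b ≠ 0)
    (hd : d ≠ 0) (hab : a ≠ b) (had : a ≠ d) (hbd : b ≠ d) {π π' : G} (h : shared T a = {π})
    (h' : shared T b = {π'}) : T d = flipAt c π' (flipAt c π (T 0)) := by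
  have hπ0 : π ∈ T 0 := (mem_shared.1 (h ▸ Finset.mem_singleton_self π)).1
  have hπ'0 : π' ∈ T 0 := (mem_shared.1 (h' ▸ Finset.mem_singleton_self π')).1
  have hππ' : π ≠ π' := by
    intro e
    have hdis := disjoint_shared hsum ha hb hab
    have hπa : π ∈ shared T a := h ▸ Finset.mem_singleton_self π
    have hπb : π ∈ shared T b := by rw [h', e]; exact Finset.mem_singleton_self π'
    exact Finset.disjoint_left.1 hdis hπa hπb
  have hmema : ∀ x, x ∈ T 0 → (x ∈ T a ↔ x = π) := by
    intro x hx
    rw [← Finset.mem_singleton, ← h, mem_shared]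
    exact ⟨fun h' => ⟨hx, h'⟩, fun h' => h'.2⟩
  have hmemb : ∀ x, x ∈ T 0 → (x ∈ T b ↔ x = π') := by
    intro x hx
    rw [← Finset.mem_singleton, ← h', mem_shared]
    exact ⟨fun h'' => ⟨hx, h''⟩, fun h'' => h''.2⟩
  have hmemd : ∀ x, x ∈ T 0 → (x ∈ T d ↔ ¬ x = π ∧ ¬ x = π') := by
    intro x hx
    obtain ⟨e, he0, he⟩ := hsum.exists_partner hx
    rw [he d hd, ← hmema x hx, ← hmemb x hx, he a ha, he b hb]
    constructor
    · rintro rfl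
      exact ⟨fun h1 => had h1, fun h1 => hbd h1⟩
    · rintro ⟨h1, h2⟩
      exact (fin4_third a b d e ha hb hd hab had hbd he0 (fun h3 => h1 h3.symm) (fun h3 => h2 h3.symm)).symm
  have hcπ : c * π ∉ T 0 := conj_not_mem_of_mem (hT 0) hπ0
  have hcπ' : c * π' ∉ T 0 := conj_not_mem_of_mem (hT 0) hπ'0
  ext x
  rw [mem_flipAt, mem_flipAt, mem_place, mem_place]
  by_cases hx : x ∈ T 0
  · rw [hmemd x hx]
    have h1 : ¬ x = c * π := fun e => hcπ (e ▸ hx)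
    have h2 : ¬ x = c * π' := fun e => hcπ' (e ▸ hx)
    constructor
    · rintro ⟨h3, h4⟩
      exact Or.inl ⟨Or.inl ⟨hx, fun h5 => h5.elim h3 h1⟩, fun h5 => h5.elim h4 h2⟩
    · rintro (⟨⟨-, h3⟩ | ⟨h3, h4⟩, h5⟩ | ⟨h3, h4⟩)
      · exact ⟨fun h6 => h3 (Or.inl h6), fun h6 => h5 (Or.inl h6)⟩
      · exact absurd hx h4
      · exfalso
        have hxπ' : x = π' := h3.resolve_right h2
        have hxπ : x = π := by
          have h6 : x = π ∨ x = c * π := by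
            by_contra hn
            exact h4 (Or.inl ⟨hx, hn⟩)
          exact h6.resolve_right h1
        exact hππ' (hxπ.symm.trans hxπ')
  · have hcx : c * x ∈ T 0 := ((hT 0).conj_mem_iff x).2 hx
    have hxd : x ∈ T d ↔ c * x = π ∨ c * x = π' := by
      rw [hT d x, hmemd (c * x) hcx]
      tauto
    have hxπ : ¬ x = π := fun e => hx (e ▸ hπ0)
    have hxπ' : ¬ x = π' := fun e => hx (e ▸ hπ'0)
    have hne : ¬ (x = c * π ∧ x = c * π') := fun ⟨e1, e2⟩ => hππ' (mul_left_cancel (e1.symm.trans e2))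
    rw [hxd, ← eq_conj_iff hc, ← eq_conj_iff hc]
    constructor
    · rintro (h1 | h1)
      · exact Or.inl ⟨Or.inr ⟨Or.inr h1, hx⟩, fun h2 => h2.elim hxπ' (fun h3 => hne ⟨h1, h3⟩)⟩
      · exact Or.inr ⟨Or.inr h1, fun h2 => h2.elim (fun h3 => hx h3.1)
          (fun h3 => h3.1.elim hxπ (fun h4 => hne ⟨h4, h1⟩))⟩
    · rintro (⟨⟨h1, -⟩ | ⟨h1, -⟩, -⟩ | ⟨h1, -⟩)
      · exact absurd h1 hx
      · exact Or.inl (h1.resolve_left hxπ)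
      · exact Or.inr (h1.resolve_left hxπ')

/-- **One conjugate corner forces a second**: if corner `a` shares nothing with `T 0` (so `T a = c • T 0`
by `shared_nonempty`), the two remaining corners `b, d` are conjugate: `T d = c • T b`.  A `SumTwo`
quadruple with a conjugate pair is two conjugate pairs — the corner product is then
`A_Φ × A_{Φ̄} × A_Ψ × A_{Ψ̄}` and its Weil class a product of two divisor classes (the faces the sealed
census excludes by `noConjugateCorners`, `route/ROUTE.md` §3.1). -/
theorem conj_of_shared_eq_empty {c : G} (hc : IsComplexConj c) {T : Fin 4 → Finset G}
    (hT : ∀ i, IsCMType c (T i)) (hsum : SumTwo T) {a b d : Fin 4} (ha : a ≠ 0) (hb : b ≠ 0)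
    (hd : d ≠ 0) (hab : a ≠ b) (had : a ≠ d) (hbd : b ≠ d) (h : shared T a = ∅) :
    T d = c • T b := by
  have hpart : ∀ x, x ∈ T 0 → (x ∈ T d ↔ x ∉ T b) := by
    intro x hx
    obtain ⟨e, he0, he⟩ := hsum.exists_partner hx
    have hea : e ≠ a := by
      intro hea
      have hxa : x ∈ shared T a := mem_shared.2 ⟨hx, (he a ha).2 hea.symm⟩
      rw [h] at hxa
      exact Finset.notMem_empty x hxa
    rw [he d hd, he b hb]
    constructor
    · rintro rfl h1
      exact hbd h1
    · intro h1
      exact (fin4_third a b d e ha hb hd hab had hbd he0 hea (fun h2 => h1 h2.symm)).symm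
  ext x
  rw [hc.mem_smul_iff]
  by_cases hx : x ∈ T 0
  · rw [hpart x hx]
    exact ((hT b).conj_mem_iff x).symm
  · have hcx : c * x ∈ T 0 := ((hT 0).conj_mem_iff x).2 hx
    rw [hT d x, hpart (c * x) hcx, not_not]

/-- The same from the conjugate corner itself: `T a = c • T 0 → T d = c • T b`. -/
theorem conj_of_eq_conj {c : G} (hc : IsComplexConj c) {T : Fin 4 → Finset G}
    (hT : ∀ i, IsCMType c (T i)) (hsum : SumTwo T) {a b d : Fin 4} (ha : a ≠ 0) (hb : b ≠ 0)
    (hd : d ≠ 0) (hab : a ≠ b) (had : a ≠ d) (hbd : b ≠ d) (h : T a = c • T 0) :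
    T d = c • T b := by
  apply conj_of_shared_eq_empty hc hT hsum ha hb hd hab had hbd
  show T 0 ∩ T a = ∅
  rw [h, Finset.eq_empty_iff_forall_notMem]
  intro x hx
  rw [Finset.mem_inter, hc.mem_smul_iff] at hx
  exact (hT 0).not_mem_and_conj_mem x hx

/-- The first corner shares everything but `p, p′` with the corner `Φ^{(pp′)}` (`p ≠ p′`). -/
theorem shared_faceCorners_three {c : G} {Φ : Finset G} (hΦ : IsCMType c Φ)
    {p p' : G} (hp : p ∈ Φ) (hp' : p' ∈ Φ) (hpp' : p ≠ p') :
    shared (faceCorners c Φ p p') 3 = Φ \ {p, p'} := by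
  ext x
  rw [mem_shared, Finset.mem_sdiff, Finset.mem_insert, Finset.mem_singleton]
  show x ∈ Φ ∧ x ∈ flipAt c p' (flipAt c p Φ) ↔ x ∈ Φ ∧ ¬ (x = p ∨ x = p')
  rw [mem_flipAt, mem_flipAt, mem_place, mem_place]
  constructor
  · rintro ⟨hx, h⟩
    refine ⟨hx, ?_⟩
    have h1 : ¬ x = c * p := fun e => conj_not_mem_of_mem hΦ hp (e ▸ hx)
    have h2 : ¬ x = c * p' := fun e => conj_not_mem_of_mem hΦ hp' (e ▸ hx)
    rcases h with ⟨⟨-, h3⟩ | ⟨-, h3⟩, h4⟩ | ⟨h3, h4⟩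
    · exact fun h5 => h5.elim (fun h6 => h3 (Or.inl h6)) (fun h6 => h4 (Or.inl h6))
    · exact absurd hx h3
    · exfalso
      have hxp' : x = p' := h3.resolve_right h2
      have hxp : x = p := by
        have h6 : x = p ∨ x = c * p := by
          by_contra hn
          exact h4 (Or.inl ⟨hx, hn⟩)
        exact h6.resolve_right h1
      exact hpp' (hxp.symm.trans hxp')
  · rintro ⟨hx, h⟩
    have h1 : ¬ x = c * p := fun e => conj_not_mem_of_mem hΦ hp (e ▸ hx)
    have h2 : ¬ x = c * p' := fun e => conj_not_mem_of_mem hΦ hp' (e ▸ hx)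
    exact ⟨hx, Or.inl ⟨Or.inl ⟨hx, fun h3 => h3.elim (fun h4 => h (Or.inl h4)) h1⟩,
      fun h3 => h3.elim (fun h4 => h (Or.inr h4)) h2⟩⟩

/-! ### Two singleton pairings make a face -/

/-- **Two singleton pairings pin the whole quadruple**: if `shared T a` and `shared T b` are singletons
`{π}`, `{π′}` (`a, b, d` the three corners other than `0`), then `π, π′ ∈ T 0` lie at distinct places and
`T a, T b, T d` are `faceCorners c (T 0) π π′ 1, 2, 3`. -/
theorem isFace_of_two_singleton_shared {c : G} (hc : IsComplexConj c) {T : Fin 4 → Finset G}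
    (hT : ∀ i, IsCMType c (T i)) (hsum : SumTwo T) {a b d : Fin 4} (ha : a ≠ 0) (hb : b ≠ 0)
    (hd : d ≠ 0) (hab : a ≠ b) (had : a ≠ d) (hbd : b ≠ d) (ca : (shared T a).card = 1)
    (cb : (shared T b).card = 1) :
    ∃ π π' : G, π ∈ T 0 ∧ π' ∈ T 0 ∧ π' ∉ place c π ∧
      T a = faceCorners c (T 0) π π' 1 ∧ T b = faceCorners c (T 0) π π' 2 ∧
      T d = faceCorners c (T 0) π π' 3 := by
  obtain ⟨π, hπ⟩ := Finset.card_eq_one.1 ca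
  obtain ⟨π', hπ'⟩ := Finset.card_eq_one.1 cb
  have hπ0 : π ∈ T 0 := (mem_shared.1 (hπ ▸ Finset.mem_singleton_self π)).1
  have hπ'0 : π' ∈ T 0 := (mem_shared.1 (hπ' ▸ Finset.mem_singleton_self π')).1
  have hππ' : π ≠ π' := by
    intro e
    have hdis := disjoint_shared hsum ha hb hab
    have hπa : π ∈ shared T a := hπ ▸ Finset.mem_singleton_self π
    have hπb : π ∈ shared T b := by rw [hπ', e]; exact Finset.mem_singleton_self π'
    exact Finset.disjoint_left.1 hdis hπa hπb
  refine ⟨π, π', hπ0, hπ'0, ?_, corner_eq_flipAt_conj hc hT hπ, corner_eq_flipAt_conj hc hT hπ',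
    corner_eq_flipAt_flipAt hc hT hsum ha hb hd hab had hbd hπ hπ'⟩
  rw [mem_place]
  rintro (e | e)
  · exact hππ' e.symm
  · exact conj_not_mem_of_mem (hT 0) hπ0 (e ▸ hπ'0)

end Corners

end HodgeRepro
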